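import Summits.QuantumFields.YangMills.Theorems.PencilRigidityNPointIsotropyDoubledOrbitKernelDegOneToolbox

/-!
# Degree-one doubled orbit kernel, II: the boosted symbol of a one-point test function

Line `complex-rotation-bandlimit` of crux `PencilRigidity.NPointIsotropy` (stmt-QuantumFields-11686), registered
stub `doubledOrbitKernel_degOne_of_universal`: second of four support files.  For a test function `G` on `(ℝ⁴)¹`
and a COMPLEX angle `θ` the boosted symbol is

  `m_G(θ, p) = ∫ G(a) exp(−(R_θ a)⁰ p₀ + i (R_θ a)¹ p₁ + i (a² p₂ + a³ p₃)) da`,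
  `(R_θ a)⁰ = cos θ a⁰ + sin θ a¹`, `(R_θ a)¹ = −sin θ a⁰ + cos θ a¹` (complex `cos`, `sin`);

for real `θ` it is the Laplace–Fourier transform of the rotated test function `R_θ G` (file III).  To keep the
Theorems files free of definitions the exponent `bexp` and the symbol `bsym` are section variables pinned by
the defining equations `hbexp`, `hbsym` (instantiated by `rfl` in file IV).  Proved here:

* `m_G(·, p)` is entire (differentiation under the integral sign over the compact support), with the derivative
  again a parameter integral; symbol and derivative are Borel in `p`;
* the CONE BOUND: `Re(exponent) = −(R_{Re θ} a)⁰ (cosh χ p₀ − sinh χ p₁)`, `χ = Im θ`, hence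
  `|m_G(θ,p)| ≤ ‖G‖₁ e^{−δ e^{−|χ|} p₀}` on `|p₁| ≤ p₀` when the support has rotated time `≥ δ`; a Cauchy bound
  for the `θ`-derivative;
* TRANSVERSE INTEGRATION BY PARTS: `m_{∂_k G} = −i p_k m_G` (`k = 2, 3`), iterated, for the symbol and its
  derivative — the source of the transverse decay needed against a merely tempered measure.
-/

noncomputable section

namespace Summit.QuantumFields.YangMills.Theorems.NPointIsotropy.ComplexRotationBandlimit

namespace DegOne

open MeasureTheory Complex Set Filter Topology Metric
open scoped ComplexConjugate SchwartzMap LineDeriv InnerProductSpace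
open Literature.MathematicalPhysics.QuantumLattice Literature.MathematicalPhysics.QuantumFieldTheory
open Summit.QuantumFields.YangMills.Theorems.NPointIsotropy.Negative (E4)

variable {bexp : ℂ → E4 → E4 → ℂ} {bsym : ((Fin 1 → E4) → ℂ) → ℂ → E4 → ℂ}

/-- The derived exponent `∂_θ bexp` is jointly continuous. [folklore] -/
theorem continuous_dexp : Continuous fun q : ℂ × E4 × E4 =>
    -((-Complex.sin q.1 * q.2.1 0 + Complex.cos q.1 * q.2.1 1) * q.2.2 0) +
      ((-Complex.cos q.1 * q.2.1 0 - Complex.sin q.1 * q.2.1 1) * q.2.2 1) * I := by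
  fun_prop

section Exponent

variable (hbexp : bexp = fun θ u p =>
    -((Complex.cos θ * u 0 + Complex.sin θ * u 1) * p 0) +
      ((-Complex.sin θ * u 0 + Complex.cos θ * u 1) * p 1 + u 2 * p 2 + u 3 * p 3) * I)
include hbexp

/-- The exponent is jointly continuous. [folklore] -/
theorem continuous_bexp : Continuous fun q : ℂ × E4 × E4 => bexp q.1 q.2.1 q.2.2 := by
  subst hbexp
  fun_prop

/-- Compositional form of the continuity of the exponent. [folklore] -/
theorem continuous_bexp_comp {X : Type*} [TopologicalSpace X] {f : X → ℂ} {g k : X → E4}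
    (hf : Continuous f) (hg : Continuous g) (hk : Continuous k) :
    Continuous fun x => bexp (f x) (g x) (k x) :=
  (continuous_bexp hbexp).comp (hf.prodMk (hg.prodMk hk))

/-- The exponent is entire in the angle, with the expected derivative. [folklore] -/
theorem hasDerivAt_bexp (θ : ℂ) (u p : E4) :
    HasDerivAt (fun θ => bexp θ u p)
      (-((-Complex.sin θ * u 0 + Complex.cos θ * u 1) * p 0) +
        ((-Complex.cos θ * u 0 - Complex.sin θ * u 1) * p 1) * I) θ := by
  subst hbexp
  have h1 : HasDerivAt (fun θ => Complex.cos θ * u 0 + Complex.sin θ * u 1)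
      (-Complex.sin θ * u 0 + Complex.cos θ * u 1) θ :=
    ((Complex.hasDerivAt_cos θ).mul_const _).add ((Complex.hasDerivAt_sin θ).mul_const _)
  have h2 : HasDerivAt (fun θ => -Complex.sin θ * u 0 + Complex.cos θ * u 1)
      (-Complex.cos θ * u 0 - Complex.sin θ * u 1) θ := by
    have := ((Complex.hasDerivAt_sin θ).neg.mul_const (u 0 : ℂ)).add
      ((Complex.hasDerivAt_cos θ).mul_const (u 1 : ℂ))
    refine this.congr_deriv ?_
    ring
  have h3 := (h1.mul_const (p 0 : ℂ)).neg.add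
    (((h2.mul_const (p 1 : ℂ)).add_const ((u 2 : ℂ) * p 2 + u 3 * p 3)).mul_const I)
  have hf : (fun θ => -((Complex.cos θ * u 0 + Complex.sin θ * u 1) * p 0) +
      ((-Complex.sin θ * u 0 + Complex.cos θ * u 1) * p 1 + u 2 * p 2 + u 3 * p 3) * I) =
      fun θ => -((Complex.cos θ * u 0 + Complex.sin θ * u 1) * p 0) +
        ((-Complex.sin θ * u 0 + Complex.cos θ * u 1) * p 1 + ((u 2 : ℂ) * p 2 + u 3 * p 3)) * I := by
    funext θ; ring
  rw [hf]
  exact h3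

/-- **Real part of the exponent**: `−(R_{Re θ} u)⁰ · (cosh χ p₀ − sinh χ p₁)`, `χ = Im θ`. [folklore] -/
theorem bexp_re (θ : ℂ) (u p : E4) :
    (bexp θ u p).re = -((Real.cos θ.re * u 0 + Real.sin θ.re * u 1) *
      (Real.cosh θ.im * p 0 - Real.sinh θ.im * p 1)) := by
  subst hbexp
  dsimp only
  rw [Complex.cos_eq θ, Complex.sin_eq θ, ← Complex.ofReal_cos, ← Complex.ofReal_sin,
    ← Complex.ofReal_cosh, ← Complex.ofReal_sinh]
  simp only [Complex.add_re, Complex.neg_re, Complex.mul_re, Complex.mul_im, Complex.sub_re,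
    Complex.sub_im, Complex.add_im, Complex.neg_im, Complex.ofReal_re, Complex.ofReal_im,
    Complex.I_re, Complex.I_im]
  ring

/-- **Pointwise bound of the integrand on the cone**: if the rotated time of `u` is at least
`c ≥ 0` then `|e^{bexp θ u p}| ≤ e^{-c e^{-|Im θ|} p₀}` for `|p₁| ≤ p₀`. [folklore] -/
theorem norm_cexp_bexp_le {θ : ℂ} {u p : E4} {c : ℝ} (hc : 0 ≤ c)
    (hcu : c ≤ Real.cos θ.re * u 0 + Real.sin θ.re * u 1) (hp : |p 1| ≤ p 0) :
    ‖cexp (bexp θ u p)‖ ≤ Real.exp (-(c * (Real.exp (-|θ.im|) * p 0))) := by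
  rw [Complex.norm_exp, Real.exp_le_exp, bexp_re hbexp, neg_le_neg_iff]
  have hp0 : 0 ≤ p 0 := (abs_nonneg _).trans hp
  have h1 := exp_neg_abs_mul_le (χ := θ.im) hp
  have h2 : 0 ≤ Real.exp (-|θ.im|) * p 0 := mul_nonneg (Real.exp_pos _).le hp0
  calc c * (Real.exp (-|θ.im|) * p 0) ≤ c * (Real.cosh θ.im * p 0 - Real.sinh θ.im * p 1) :=
        mul_le_mul_of_nonneg_left h1 hc
    _ ≤ (Real.cos θ.re * u 0 + Real.sin θ.re * u 1) * (Real.cosh θ.im * p 0 - Real.sinh θ.im * p 1) :=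
        mul_le_mul_of_nonneg_right hcu (h2.trans h1)

/-- A transverse shift of the argument shifts the exponent by `i t p_k` (`k = 2, 3`). [folklore] -/
theorem bexp_transverse_shift (θ : ℂ) (a : Fin 1 → E4) (p : E4) (t : ℝ) {k : Fin 4}
    (hk : k = 2 ∨ k = 3) {v : Fin 1 → E4} (hv : v = fun _ => EuclideanSpace.single k (1 : ℝ)) :
    bexp θ ((a + t • v) 0) p = bexp θ (a 0) p + (t : ℂ) * ((p k : ℂ) * I) := by
  subst hbexp hv
  rcases hk with rfl | rfl
  · simp only [Pi.add_apply, Pi.smul_apply, PiLp.add_apply, PiLp.smul_apply,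
      smul_eq_mul, PiLp.single_apply]
    simp only [show ((0 : Fin 4) = 2) = False by decide, show ((1 : Fin 4) = 2) = False by decide,
      show ((3 : Fin 4) = 2) = False by decide, if_false, if_true, mul_zero, add_zero, mul_one]
    push_cast
    ring
  · simp only [Pi.add_apply, Pi.smul_apply, PiLp.add_apply, PiLp.smul_apply,
      smul_eq_mul, PiLp.single_apply]
    simp only [show ((0 : Fin 4) = 3) = False by decide, show ((1 : Fin 4) = 3) = False by decide,
      show ((2 : Fin 4) = 3) = False by decide, if_false, if_true, mul_zero, add_zero, mul_one]
    push_cast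
    ring

/-- The transverse line derivative of the exponential factor. [folklore] -/
theorem hasLineDerivAt_cexp_bexp (θ : ℂ) (p : E4) {k : Fin 4} (hk : k = 2 ∨ k = 3)
    {v : Fin 1 → E4} (hv : v = fun _ => EuclideanSpace.single k (1 : ℝ)) (a : Fin 1 → E4) :
    HasLineDerivAt ℝ (fun a : Fin 1 → E4 => cexp (bexp θ (a 0) p))
      (cexp (bexp θ (a 0) p) * ((p k : ℂ) * I)) a v := by
  unfold HasLineDerivAt
  have h1 : HasDerivAt (fun t : ℝ => bexp θ (a 0) p + (t : ℂ) * ((p k : ℂ) * I))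
      (((1 : ℝ) : ℂ) * ((p k : ℂ) * I)) 0 :=
    ((hasDerivAt_id (0 : ℝ)).ofReal_comp.mul_const _).const_add _
  have h2 := h1.cexp
  have hfun : (fun t : ℝ => cexp (bexp θ ((a + t • v) 0) p)) =
      fun t : ℝ => cexp (bexp θ (a 0) p + (t : ℂ) * ((p k : ℂ) * I)) := by
    funext t; rw [bexp_transverse_shift hbexp θ a p t hk hv]
  rw [hfun]
  refine h2.congr_deriv ?_
  simp

section Symbol

variable (hbsym : bsym = fun G θ p => ∫ a : Fin 1 → E4, G a * cexp (bexp θ (a 0) p))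
include hbsym

/-- **The symbol is entire in the angle**, with derivative the derived parameter integral
(differentiation under the integral sign over the compact support). [folklore] -/
theorem hasDerivAt_bsym (G : 𝓢((Fin 1 → E4), ℂ)) (hGc : HasCompactSupport (G : (Fin 1 → E4) → ℂ))
    (p : E4) (θ₀ : ℂ) :
    HasDerivAt (fun θ => bsym G θ p) (∫ a : Fin 1 → E4, G a * (cexp (bexp θ₀ (a 0) p) *
      (-((-Complex.sin θ₀ * (a 0) 0 + Complex.cos θ₀ * (a 0) 1) * p 0) +
        ((-Complex.cos θ₀ * (a 0) 0 - Complex.sin θ₀ * (a 0) 1) * p 1) * I))) θ₀ := by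
  simp only [hbsym]
  have hK : IsCompact (tsupport (G : (Fin 1 → E4) → ℂ) ×ˢ closedBall θ₀ 1) :=
    hGc.prod (isCompact_closedBall θ₀ 1)
  have hce : ∀ θ : ℂ, Continuous fun a : Fin 1 → E4 => cexp (bexp θ (a 0) p) := fun θ =>
    Complex.continuous_exp.comp (continuous_bexp_comp hbexp continuous_const (by fun_prop) continuous_const)
  have hc : Continuous fun q : (Fin 1 → E4) × ℂ => cexp (bexp q.2 (q.1 0) p) *
      (-((-Complex.sin q.2 * (q.1 0) 0 + Complex.cos q.2 * (q.1 0) 1) * p 0) +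
        ((-Complex.cos q.2 * (q.1 0) 0 - Complex.sin q.2 * (q.1 0) 1) * p 1) * I) :=
    (Complex.continuous_exp.comp
      (continuous_bexp_comp hbexp continuous_snd (by fun_prop) continuous_const)).mul (by fun_prop)
  obtain ⟨M, hM⟩ := hK.exists_bound_of_continuousOn hc.continuousOn
  have key := hasDerivAt_integral_of_dominated_loc_of_deriv_le (μ := volume)
    (F := fun θ a => G a * cexp (bexp θ (a 0) p))
    (F' := fun θ a => G a * (cexp (bexp θ (a 0) p) *
      (-((-Complex.sin θ * (a 0) 0 + Complex.cos θ * (a 0) 1) * p 0) +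
        ((-Complex.cos θ * (a 0) 0 - Complex.sin θ * (a 0) 1) * p 1) * I)))
    (bound := fun a => ‖G a‖ * M) (x₀ := θ₀) (s := ball θ₀ 1) (ball_mem_nhds θ₀ one_pos)
    (Eventually.of_forall fun θ => (G.continuous.mul (hce θ)).aestronglyMeasurable)
    ((G.continuous.mul (hce θ₀)).integrable_of_hasCompactSupport hGc.mul_right)
    ((G.continuous.mul (hc.comp (Continuous.prodMk_left θ₀))).aestronglyMeasurable)
    (ae_of_all _ fun a θ hθ => ?_) ((schwartz_integrable G).norm.mul_const M)
    (ae_of_all _ fun a θ _ => ((hasDerivAt_bexp hbexp θ (a 0) p).cexp.const_mul (G a)))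
  · exact key.2
  · by_cases ha : a ∈ tsupport (G : (Fin 1 → E4) → ℂ)
    · rw [norm_mul]
      exact mul_le_mul_of_nonneg_left
        (hM ⟨a, θ⟩ ⟨ha, mem_closedBall.2 (le_of_lt (mem_ball.1 hθ))⟩) (norm_nonneg _)
    · simp [image_eq_zero_of_notMem_tsupport ha]

/-- The symbol is an entire function of the angle. [folklore] -/
theorem differentiable_bsym (G : 𝓢((Fin 1 → E4), ℂ)) (hGc : HasCompactSupport (G : (Fin 1 → E4) → ℂ))
    (p : E4) : Differentiable ℂ fun θ => bsym G θ p :=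
  fun θ => (hasDerivAt_bsym hbexp hbsym G hGc p θ).differentiableAt

/-- The symbol is Borel measurable in the momentum. [folklore] -/
theorem stronglyMeasurable_bsym (G : 𝓢((Fin 1 → E4), ℂ)) (θ : ℂ) :
    StronglyMeasurable fun p => bsym G θ p := by
  simp only [hbsym]
  have hc : Continuous fun q : E4 × (Fin 1 → E4) => G q.2 * cexp (bexp θ (q.2 0) q.1) :=
    (G.continuous.comp continuous_snd).mul (Complex.continuous_exp.comp
      (continuous_bexp_comp hbexp continuous_const (by fun_prop) continuous_fst))
  exact hc.stronglyMeasurable.integral_prod_right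

/-- The `θ`-derivative of the symbol is Borel measurable in the momentum. [folklore] -/
theorem stronglyMeasurable_deriv_bsym (G : 𝓢((Fin 1 → E4), ℂ))
    (hGc : HasCompactSupport (G : (Fin 1 → E4) → ℂ)) (θ : ℂ) :
    StronglyMeasurable fun p => deriv (fun θ => bsym G θ p) θ := by
  have hfun : (fun p => deriv (fun θ => bsym G θ p) θ) = fun p => ∫ a : Fin 1 → E4, G a *
      (cexp (bexp θ (a 0) p) * (-((-Complex.sin θ * (a 0) 0 + Complex.cos θ * (a 0) 1) * p 0) +
        ((-Complex.cos θ * (a 0) 0 - Complex.sin θ * (a 0) 1) * p 1) * I)) :=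
    funext fun p => (hasDerivAt_bsym hbexp hbsym G hGc p θ).deriv
  rw [hfun]
  have hc : Continuous fun q : E4 × (Fin 1 → E4) => G q.2 *
      (cexp (bexp θ (q.2 0) q.1) * (-((-Complex.sin θ * (q.2 0) 0 + Complex.cos θ * (q.2 0) 1) * q.1 0) +
        ((-Complex.cos θ * (q.2 0) 0 - Complex.sin θ * (q.2 0) 1) * q.1 1) * I)) :=
    (G.continuous.comp continuous_snd).mul ((Complex.continuous_exp.comp
      (continuous_bexp_comp hbexp continuous_const (by fun_prop) continuous_fst)).mul (by fun_prop))
  exact hc.stronglyMeasurable.integral_prod_right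

/-- **Bound of the symbol on the cone**: if every point of the support of `G` has rotated time
`≥ δ ≥ 0` at the angle `Re θ`, then `|m_G(θ,p)| ≤ ‖G‖_{L¹} e^{-δ e^{-|Im θ|} p₀}` on `|p₁| ≤ p₀`. [folklore] -/
theorem norm_bsym_le (G : 𝓢((Fin 1 → E4), ℂ)) {θ : ℂ} {δ : ℝ} (hδ : 0 ≤ δ)
    (hG : ∀ a ∈ tsupport (G : (Fin 1 → E4) → ℂ), δ ≤ Real.cos θ.re * a 0 0 + Real.sin θ.re * a 0 1)
    {p : E4} (hp : |p 1| ≤ p 0) :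
    ‖bsym G θ p‖ ≤ (∫ a, ‖G a‖) * Real.exp (-(δ * (Real.exp (-|θ.im|) * p 0))) := by
  rw [hbsym, ← integral_mul_const]
  refine norm_integral_le_of_norm_le ((schwartz_integrable G).norm.mul_const _) (ae_of_all _ fun a => ?_)
  by_cases ha : a ∈ tsupport (G : (Fin 1 → E4) → ℂ)
  · rw [norm_mul]
    exact mul_le_mul_of_nonneg_left (norm_cexp_bexp_le hbexp hδ (hG a ha) hp) (norm_nonneg _)
  · simp [image_eq_zero_of_notMem_tsupport ha]

/-- **Cauchy bound for the derivative of the symbol**: a bound of the symbol on a circle of radius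
`r` about `θ` bounds the `θ`-derivative by `B / r`. [folklore] -/
theorem norm_deriv_bsym_le_of_sphere (G : 𝓢((Fin 1 → E4), ℂ))
    (hGc : HasCompactSupport (G : (Fin 1 → E4) → ℂ)) (p : E4) {θ : ℂ} {r B : ℝ} (hr : 0 < r)
    (hB : ∀ ζ ∈ sphere θ r, ‖bsym G ζ p‖ ≤ B) :
    ‖deriv (fun θ => bsym G θ p) θ‖ ≤ B / r :=
  Complex.norm_deriv_le_of_forall_mem_sphere_norm_le hr
    (differentiable_bsym hbexp hbsym G hGc p).diffContOnCl hB

/-! ## Transverse integration by parts -/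

/-- **Transverse integration by parts**: `m_{∂_k G}(θ,p) = −i p_k · m_G(θ,p)` for `k = 2, 3`
(the exponent is linear in the transverse coordinates with coefficient `i p_k`). [folklore] -/
theorem bsym_lineDeriv (G : 𝓢((Fin 1 → E4), ℂ)) (hGc : HasCompactSupport (G : (Fin 1 → E4) → ℂ))
    (θ : ℂ) (p : E4) {k : Fin 4} (hk : k = 2 ∨ k = 3) {v : Fin 1 → E4}
    (hv : v = fun _ => EuclideanSpace.single k (1 : ℝ)) :
    bsym (∂_{v} G : 𝓢((Fin 1 → E4), ℂ)) θ p = -((p k : ℂ) * I) * bsym G θ p := by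
  have hf : ∀ a, HasLineDerivAt ℝ (G : (Fin 1 → E4) → ℂ)
      ((∂_{v} G : 𝓢((Fin 1 → E4), ℂ)) a) a v := fun a => by
    rw [SchwartzMap.lineDerivOp_apply_eq_fderiv]
    exact (G.hasFDerivAt a).hasLineDerivAt _
  have hgc : Continuous fun a : Fin 1 → E4 => cexp (bexp θ (a 0) p) :=
    Complex.continuous_exp.comp (continuous_bexp_comp hbexp continuous_const (by fun_prop) continuous_const)
  have hDc : HasCompactSupport (((∂_{v} G : 𝓢((Fin 1 → E4), ℂ))) : (Fin 1 → E4) → ℂ) :=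
    hasCompactSupport_iterate_lineDeriv G hGc v 1
  have i1 : Integrable (fun a => ContinuousLinearMap.mul ℝ ℂ ((∂_{v} G : 𝓢((Fin 1 → E4), ℂ)) a)
      (cexp (bexp θ (a 0) p))) volume := by
    simp only [ContinuousLinearMap.mul_apply']
    exact ((∂_{v} G : 𝓢((Fin 1 → E4), ℂ)).continuous.mul hgc).integrable_of_hasCompactSupport
      hDc.mul_right
  have i2 : Integrable (fun a => ContinuousLinearMap.mul ℝ ℂ (G a)
      (cexp (bexp θ (a 0) p) * ((p k : ℂ) * I))) volume := by
    simp only [ContinuousLinearMap.mul_apply']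
    exact (G.continuous.mul (hgc.mul continuous_const)).integrable_of_hasCompactSupport hGc.mul_right
  have i3 : Integrable (fun a => ContinuousLinearMap.mul ℝ ℂ (G a) (cexp (bexp θ (a 0) p))) volume := by
    simp only [ContinuousLinearMap.mul_apply']
    exact (G.continuous.mul hgc).integrable_of_hasCompactSupport hGc.mul_right
  have key := integral_bilinear_hasLineDerivAt_right_eq_neg_left_of_integrable (μ := volume)
    (B := ContinuousLinearMap.mul ℝ ℂ) (f := (G : (Fin 1 → E4) → ℂ))
    (f' := ((∂_{v} G : 𝓢((Fin 1 → E4), ℂ)) : (Fin 1 → E4) → ℂ))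
    (g := fun a : Fin 1 → E4 => cexp (bexp θ (a 0) p))
    (g' := fun a : Fin 1 → E4 => cexp (bexp θ (a 0) p) * ((p k : ℂ) * I)) (v := v)
    i1 i2 i3 (fun a _ => hf a) (fun a _ => hasLineDerivAt_cexp_bexp hbexp θ p hk hv a)
  simp only [ContinuousLinearMap.mul_apply'] at key
  have lhs : ∫ a, G a * (cexp (bexp θ (a 0) p) * ((p k : ℂ) * I)) = bsym G θ p * ((p k : ℂ) * I) := by
    rw [hbsym, ← integral_mul_const]
    congr 1; funext a; ring
  rw [lhs, hbsym] at key
  rw [hbsym]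
  dsimp only at key ⊢
  linear_combination key

/-- Iterated transverse integration by parts. [folklore] -/
theorem bsym_iterate_lineDeriv (G : 𝓢((Fin 1 → E4), ℂ))
    (hGc : HasCompactSupport (G : (Fin 1 → E4) → ℂ)) (θ : ℂ) (p : E4) {k : Fin 4}
    (hk : k = 2 ∨ k = 3) {v : Fin 1 → E4} (hv : v = fun _ => EuclideanSpace.single k (1 : ℝ)) (n : ℕ) :
    bsym ((∂_{v})^[n] G : 𝓢((Fin 1 → E4), ℂ)) θ p = (-((p k : ℂ) * I)) ^ n * bsym G θ p := by
  induction n with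
  | zero => simp
  | succ n ih =>
    rw [Function.iterate_succ_apply', bsym_lineDeriv hbexp hbsym _
      (hasCompactSupport_iterate_lineDeriv G hGc _ n) θ p hk hv, ih, pow_succ]
    ring

/-- **Transverse decay of the symbol**: `|p_k|^n |m_G| = |m_{∂_k^n G}|`. [folklore] -/
theorem pow_mul_norm_bsym (G : 𝓢((Fin 1 → E4), ℂ))
    (hGc : HasCompactSupport (G : (Fin 1 → E4) → ℂ)) (θ : ℂ) (p : E4) {k : Fin 4}
    (hk : k = 2 ∨ k = 3) {v : Fin 1 → E4} (hv : v = fun _ => EuclideanSpace.single k (1 : ℝ)) (n : ℕ) :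
    |p k| ^ n * ‖bsym G θ p‖ = ‖bsym ((∂_{v})^[n] G : 𝓢((Fin 1 → E4), ℂ)) θ p‖ := by
  rw [bsym_iterate_lineDeriv hbexp hbsym G hGc θ p hk hv n, norm_mul, norm_pow, norm_neg, norm_mul,
    Complex.norm_I, mul_one, Complex.norm_real, Real.norm_eq_abs]

/-- **Transverse decay of the derivative of the symbol**: `|p_k|^n |∂_θ m_G| = |∂_θ m_{∂_k^n G}|`. [folklore] -/
theorem pow_mul_norm_deriv_bsym (G : 𝓢((Fin 1 → E4), ℂ))
    (hGc : HasCompactSupport (G : (Fin 1 → E4) → ℂ)) (θ : ℂ) (p : E4) {k : Fin 4}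
    (hk : k = 2 ∨ k = 3) {v : Fin 1 → E4} (hv : v = fun _ => EuclideanSpace.single k (1 : ℝ)) (n : ℕ) :
    |p k| ^ n * ‖deriv (fun θ => bsym G θ p) θ‖ =
      ‖deriv (fun θ => bsym ((∂_{v})^[n] G : 𝓢((Fin 1 → E4), ℂ)) θ p) θ‖ := by
  have hfun : (fun θ => bsym ((∂_{v})^[n] G : 𝓢((Fin 1 → E4), ℂ)) θ p) =
      fun θ => (-((p k : ℂ) * I)) ^ n * bsym G θ p :=
    funext fun θ => bsym_iterate_lineDeriv hbexp hbsym G hGc θ p hk hv n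
  rw [hfun, deriv_const_mul _ (differentiable_bsym hbexp hbsym G hGc p θ), norm_mul, norm_pow, norm_neg,
    norm_mul, Complex.norm_I, mul_one, Complex.norm_real, Real.norm_eq_abs]

end Symbol

end Exponent

end DegOne

/-- **The boosted symbol of a compactly supported one-point test function is entire in the complex angle**
(registered form of file II's `DegOne.differentiable_bsym`, with the exponent written out). [folklore] -/
theorem boostedSymbol_differentiable : ∀ (G : SchwartzMap (Fin 1 → EuclideanSpace ℝ (Fin 4)) ℂ), HasCompactSupport (G : (Fin 1 → EuclideanSpace ℝ (Fin 4)) → ℂ) → ∀ (p : EuclideanSpace ℝ (Fin 4)), Differentiable ℂ fun θ : ℂ => ∫ a : Fin 1 → EuclideanSpace ℝ (Fin 4), G a * Complex.exp (-((Complex.cos θ * (a 0) 0 + Complex.sin θ * (a 0) 1) * p 0) + ((-Complex.sin θ * (a 0) 0 + Complex.cos θ * (a 0) 1) * p 1 + (a 0) 2 * p 2 + (a 0) 3 * p 3) * Complex.I) :=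
  fun G hGc p => DegOne.differentiable_bsym rfl rfl G hGc p

end Summit.QuantumFields.YangMills.Theorems.NPointIsotropy.ComplexRotationBandlimit

end
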